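import Mathlib.Topology.Irreducible
import Mathlib.Topology.Connected.Clopen
import Mathlib.Topology.NoetherianSpace
import HarnessLib

/-!
# Components of Noetherian spaces: clopen connected components, traces along open embeddings, shrinking the base

Topic: `Literature/AlgebraicGeometry/Resolution`. Three pieces of point-set topology used in
de Jong 1996, 4.12 ("`Y' → ℙ^{d-1}` is (finite) étale") to shrink an étale neighbourhood
`U → ℙ^{d-1}` of a point `u` so that it is connected and every irreducible component of the
base-changed `X'_U` meets the fibre over `u`:

* `isClopen_connectedComponent_of_finite_irreducibleComponents` — with finitely many
  irreducible components (e.g. a Noetherian space), connected components are open and closed;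
* `exists_preimage_eq_of_mem_irreducibleComponents` — along an open embedding `e : A → B`
  every irreducible component of `A` is the trace `e⁻¹ Z` of an irreducible component `Z` of
  `B` meeting the image (the converse of Mathlib's `preimage_mem_irreducibleComponents`);
* `exists_isOpen_forall_mem_image_of_isClosedMap` — for a closed map `p : E → U` from a space
  with finitely many irreducible components and `u ∈ U`, there is an open `O ∋ u` such that
  every irreducible component of `E` meeting `p⁻¹ O` has `u` in its image (remove the images,
  closed, of the finitely many components missing `u`).

[folklore]; no definitions, no named facts.

## Sources

* A. J. de Jong, *Smoothness, semi-stability and alterations*, Publ. Math. IHÉS 83 (1996), 4.12,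
  p. 68 (the use). [DeJong1996]
-/

open Set Topology TopologicalSpace

namespace Literature.AlgebraicGeometry.Resolution

/-- **Connected components are clopen when there are finitely many irreducible components**
(e.g. in a Noetherian space): the complement of the connected component of `x` is the union of
the irreducible components disjoint from it — an irreducible component meeting it is connected,
hence inside it. [folklore] -/
theorem isClopen_connectedComponent_of_finite_irreducibleComponents {α : Type*}
    [TopologicalSpace α] (hfin : (irreducibleComponents α).Finite) (x : α) :
    IsClopen (connectedComponent x) := by
  refine ⟨isClosed_connectedComponent, ?_⟩
  have hc : (connectedComponent x)ᶜ =
      ⋃₀ {Z ∈ irreducibleComponents α | Disjoint Z (connectedComponent x)} := by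
    ext z
    constructor
    · intro hz
      refine ⟨irreducibleComponent z, ⟨irreducibleComponent_mem_irreducibleComponents z, ?_⟩,
        mem_irreducibleComponent⟩
      rw [Set.disjoint_iff]
      rintro w ⟨hw1, hw2⟩
      apply hz
      have h1 : irreducibleComponent z ⊆ connectedComponent w :=
        isIrreducible_irreducibleComponent.2.isPreconnected.subset_connectedComponent hw1
      rw [← connectedComponent_eq hw2] at h1
      exact h1 mem_irreducibleComponent
    · rintro ⟨Z, ⟨-, hdisj⟩, hzZ⟩ hz
      exact Set.disjoint_iff.mp hdisj ⟨hzZ, hz⟩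
  rw [← isClosed_compl_iff, hc, Set.sUnion_eq_biUnion]
  exact (hfin.subset fun Z hZ => hZ.1).isClosed_biUnion
    fun Z hZ => isClosed_of_mem_irreducibleComponents Z hZ.1

/-- In a Noetherian space connected components are clopen. [folklore] -/
theorem isClopen_connectedComponent_of_noetherianSpace {α : Type*} [TopologicalSpace α]
    [NoetherianSpace α] (x : α) : IsClopen (connectedComponent x) :=
  isClopen_connectedComponent_of_finite_irreducibleComponents
    NoetherianSpace.finite_irreducibleComponents x

/-- **Irreducible components of an open subspace are traces**: along an open embedding
`e : A → B`, every irreducible component `C` of `A` is `e⁻¹ Z` for an irreducible component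
`Z` of `B` meeting the image of `e` (take `Z ⊇ e(C)`; `e⁻¹ Z` is an irreducible component of
`A` by Mathlib's `preimage_mem_irreducibleComponents` and contains `C`). [folklore] -/
theorem exists_preimage_eq_of_mem_irreducibleComponents {A B : Type*} [TopologicalSpace A]
    [TopologicalSpace B] {e : A → B} (he : IsOpenEmbedding e) {C : Set A}
    (hC : C ∈ irreducibleComponents A) :
    ∃ Z ∈ irreducibleComponents B, (Z ∩ Set.range e).Nonempty ∧ e ⁻¹' Z = C := by
  have hCi : IsIrreducible (e '' C) := hC.1.image e he.continuous.continuousOn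
  obtain ⟨Z, hZ, hCZ⟩ := exists_mem_irreducibleComponents_subset_of_isIrreducible _ hCi
  have hne : (Z ∩ Set.range e).Nonempty := by
    obtain ⟨a, ha⟩ := hC.1.nonempty
    exact ⟨e a, hCZ ⟨a, ha, rfl⟩, a, rfl⟩
  refine ⟨Z, hZ, hne, ?_⟩
  have h1 : e ⁻¹' Z ∈ irreducibleComponents A := preimage_mem_irreducibleComponents hZ he hne
  have h2 : C ⊆ e ⁻¹' Z := fun a ha => hCZ ⟨a, ha, rfl⟩
  exact Set.Subset.antisymm (hC.2 h1.1 h2) h2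

/-- **Shrinking the base so that every component meets a given fibre**: let `p : E → U` be a
closed map from a space with finitely many irreducible components and `u ∈ U`. There is an
open `O ∋ u` such that every irreducible component of `E` meeting `p⁻¹ O` has `u` in its
image: remove from `U` the (closed) images of the finitely many components whose image misses
`u`. [folklore] -/
theorem exists_isOpen_forall_mem_image_of_isClosedMap {E U : Type*} [TopologicalSpace E]
    [TopologicalSpace U] (hfin : (irreducibleComponents E).Finite) {p : E → U}
    (hp : IsClosedMap p) (u : U) :
    ∃ O : Set U, IsOpen O ∧ u ∈ O ∧ ∀ Z ∈ irreducibleComponents E,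
      (Z ∩ p ⁻¹' O).Nonempty → u ∈ p '' Z := by
  refine ⟨(⋃₀ ((fun Z => p '' Z) '' {Z ∈ irreducibleComponents E | u ∉ p '' Z}))ᶜ, ?_, ?_, ?_⟩
  · rw [isOpen_compl_iff, Set.sUnion_eq_biUnion]
    refine ((hfin.subset fun Z hZ => hZ.1).image _).isClosed_biUnion ?_
    rintro _ ⟨Z, hZ, rfl⟩
    exact hp _ (isClosed_of_mem_irreducibleComponents Z hZ.1)
  · rintro ⟨_, ⟨Z, hZ, rfl⟩, huZ⟩
    exact hZ.2 huZ
  · rintro Z hZ ⟨z, hzZ, hzO⟩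
    by_contra hu
    apply hzO
    exact ⟨p '' Z, ⟨Z, ⟨hZ, hu⟩, rfl⟩, z, hzZ, rfl⟩

end Literature.AlgebraicGeometry.Resolution
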